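import Summits.QuantumFields.YangMills.Theorems.LuscherReductionOneSiteLevelsVariational
import Summits.QuantumFields.YangMills.Theorems.LuscherReductionOneSiteLevelsIMSDefect

/-!
# The composition seam of `stub_absUpper`: inner comparison + outer bound + IMS phase ⟹ `OneSiteAbsUpper k`
# (support module for the registered stub `stub_absUpper` of crux `OneSiteLevels`, route `LuscherReduction`, item stmt-QuantumFields-20007;
# fleet lead prover ym-luscher-20007-p1; line card `Lines/energy-lower-abs.md` §3 AU1–AU3)

`OneSiteAbsUpper k` (skeleton v5, registered 2026-08-26: `μ_k ≤ c(B)³ e^{−E_kλ_b + Cλ_b²}` eventually, `E_k = physLevel (k+1)`,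
`c(B) = oneLinkFactor B = linkC B`) is the hard half of the crux.  This module PROVES its composition from three analytic inputs of
exactly stated shape, so that the planner can register them as sub-stubs and provers can attack them separately:

* (PHASE) for every large `B` a measurable, gauge- and twist-invariant, link-Lipschitz phase `Θ_B : Cfg → ℝ` with Lipschitz constant
  `Λ_B² ≤ A/λ_b(B)` (cut-offs at link scale `ℓ ≍ λ_b^{1/2}`; e.g. `Θ_B = (π/2)(1 − Π_e clamp01(2 − vacDist(U_e)/ℓ))`) — cheap, constructive;
* (INNER, the XL core) `k` physical constraint functions `φ_i` such that every physical `ψ ⊥ φ_i` has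
  `⟨cos Θ_B·ψ, K_B cos Θ_B·ψ⟩ ≤ linkCE B · e^{−E_kλ_b + C₁λ_b²} ‖cos Θ_B·ψ‖²` — the Kac/Trotter comparison with `e^{−λ_b𝔥}` on the toron balls;
* (OUTER, L) every physical `ψ` has `⟨sin Θ_B·ψ, K_B sin Θ_B·ψ⟩ ≤ linkCE B · e^{−E_kλ_b + C₁λ_b²} ‖sin Θ_B·ψ‖²` — transverse confinement along the
  toron valley and `e^{−BS}` suppression away from it (any stronger rate may be weakened to this one).
THEN (`absUpper_of_localized`): `∃ C B0, ∀ B ≥ B0, levelValue su2Rep 1 B k ≤ linkC B ^ 3 · e^{−E_kλ_b + Cλ_b²}` — `OneSiteAbsUpper k` with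
`oneLinkFactor = linkC` (`rfl`).  Ingredients: the IMS inequality with the defect-row bound (`qform_le_localized_cos_sin`, `defect_scale`:
error `≤ (9/4)·A·cM2·λ_b²·linkCE‖ψ‖²`), `‖cos Θψ‖² + ‖sin Θψ‖² = ‖ψ‖²`, the absorption `a + Dλ² ≤ a·e^{MDλ²}` (`1 + x ≤ eˣ`), and the inf–sup door
`levelValue_le_of_forall_rayleigh_le`.

## WHAT THIS IS NOT
Neither INNER nor OUTER is proved here; NOT the crux, NOT THE CLAY GAP.  Sorry-free; no new definition, no named fact.
-/

set_option autoImplicit false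

noncomputable section

open MeasureTheory Filter Topology Real
open scoped Matrix ComplexConjugate BigOperators
open Literature.MathematicalPhysics.QuantumFieldTheory
open Literature.MathematicalPhysics.QuantumLattice
open Literature.Analysis.OperatorTheory.YMMatrixModel

namespace Summit.QuantumFields.YangMills.Theorems.FemtoTransferGap

/-- For a physical `ψ` and a bounded (`|f| ≤ 1`) continuous function of a measurable phase, `(f∘Θ · ψ)²` is integrable. [folklore] -/
theorem integrable_phaseMul_sq {Θ : Cfg → ℝ} (hΘm : Measurable Θ) {ψ : Cfg → ℝ} (hψ : IsPhys ψ)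
    (f : ℝ → ℝ) (hf : Continuous f) (hf1 : ∀ x, |f x| ≤ 1) :
    Integrable (fun U => f (Θ U) * ψ U * (f (Θ U) * ψ U)) (configMeasure SU2 1) := by
  obtain ⟨C, hC⟩ := hψ.bounded
  have hm : Measurable (fun U => f (Θ U) * ψ U * (f (Θ U) * ψ U)) :=
    ((hf.measurable.comp hΘm).mul hψ.measurable).mul ((hf.measurable.comp hΘm).mul hψ.measurable)
  refine Integrable.mono' (integrable_const (C * C)) hm.aestronglyMeasurable (ae_of_all _ fun U => ?_)
  rw [Real.norm_eq_abs, abs_mul, abs_mul]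
  have hC0 : 0 ≤ C := (abs_nonneg _).trans (hC U)
  have h1 : |f (Θ U)| * |ψ U| ≤ C := by
    have := mul_le_mul (hf1 (Θ U)) (hC U) (abs_nonneg _) zero_le_one
    rwa [one_mul] at this
  exact mul_le_mul h1 h1 (by positivity) hC0

/-- `‖cos Θ·ψ‖² + ‖sin Θ·ψ‖² = ‖ψ‖²` for a physical `ψ` and a measurable phase. [folklore] -/
theorem l2_cos_mul_add_l2_sin_mul {Θ : Cfg → ℝ} (hΘm : Measurable Θ) {ψ : Cfg → ℝ} (hψ : IsPhys ψ) :
    l2 (fun U => Real.cos (Θ U) * ψ U) (fun U => Real.cos (Θ U) * ψ U)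
      + l2 (fun U => Real.sin (Θ U) * ψ U) (fun U => Real.sin (Θ U) * ψ U) = l2 ψ ψ := by
  unfold l2
  rw [← integral_add (integrable_phaseMul_sq hΘm hψ Real.cos Real.continuous_cos Real.abs_cos_le_one)
    (integrable_phaseMul_sq hΘm hψ Real.sin Real.continuous_sin Real.abs_sin_le_one)]
  refine integral_congr_ae (ae_of_all _ fun U => ?_)
  have h := Real.cos_sq_add_sin_sq (Θ U)
  simp only
  linear_combination (ψ U * ψ U) * h

/-- Absorption of a quadratic error into the exponent: `e^{a} + D x² ≤ e^{a + M D x²}` whenever `0 ≤ D`, and `e^{−a} ≤ M`. [folklore] -/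
theorem exp_add_mul_sq_le {a D M x : ℝ} (hD : 0 ≤ D) (hM : Real.exp (-a) ≤ M) :
    Real.exp a + D * x ^ 2 ≤ Real.exp (a + M * D * x ^ 2) := by
  have hea : 0 < Real.exp a := Real.exp_pos a
  have h1 : D * x ^ 2 ≤ Real.exp a * (M * D * x ^ 2) := by
    have : D * x ^ 2 = Real.exp a * (Real.exp (-a) * D * x ^ 2) := by
      rw [← mul_assoc, ← mul_assoc, ← Real.exp_add, add_neg_cancel, Real.exp_zero, one_mul]
    rw [this]
    exact mul_le_mul_of_nonneg_left (mul_le_mul_of_nonneg_right (mul_le_mul_of_nonneg_right hM hD) (sq_nonneg _)) hea.le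
  calc Real.exp a + D * x ^ 2 ≤ Real.exp a * (1 + M * D * x ^ 2) := by rw [mul_add, mul_one]; linarith
    _ ≤ Real.exp a * Real.exp (M * D * x ^ 2) :=
        mul_le_mul_of_nonneg_left (by linarith [Real.add_one_le_exp (M * D * x ^ 2)]) hea.le
    _ = Real.exp (a + M * D * x ^ 2) := by rw [Real.exp_add]

/-- `0 < λ_b ≤ 1` for `B ≥ 2`. [cite: Luscher1983, §1] -/
theorem bareLambda_pos_le_one {B : ℝ} (hB : 2 ≤ B) : 0 < bareLambda B ∧ bareLambda B ≤ 1 := by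
  unfold bareLambda
  have hBpos : 0 < B := by linarith
  exact ⟨Real.rpow_pos_of_pos (by positivity) _,
    Real.rpow_le_one (by positivity) ((div_le_one hBpos).mpr hB) (by norm_num)⟩

/-- **COMPOSITION SEAM OF `stub_absUpper`.**  From (PHASE) measurable gauge- and twist-invariant link-Lipschitz phases `Θ_B` with
`Λ_B² ≤ A/λ_b`, (INNER) `k` physical constraints controlling the `cos Θ_B`-piece of every physical `ψ ⊥ φ_i` at rate
`linkCE B · e^{−E_kλ_b + C₁λ_b²}`, and (OUTER) the same rate for the `sin Θ_B`-piece of every physical `ψ`, all for `B ≥ B₁ ≥ 2`: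
`∃ C B0, ∀ B ≥ B0, λ_k ≤ linkC B ^ 3 · e^{−E_kλ_b + Cλ_b²}`, i.e. `OneSiteAbsUpper k` (`E_k = physLevel (k+1)`, `oneLinkFactor = linkC`),
with `C = C₁ + e^{|E_k| + |C₁|}·(9/4)·A·cM2`, `B0 = B₁`. [cite: SimonB1983DiscreteSpectrum, §3] [cite: ReedSimonIV1978, Thm. XIII.1] -/
theorem absUpper_of_localized (k : ℕ) {A C₁ B₁ : ℝ} (hB₁ : 2 ≤ B₁) (hA : 0 ≤ A) (Θ : ℝ → Cfg → ℝ) (Λ : ℝ → ℝ)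
    (hΘm : ∀ B, Measurable (Θ B))
    (hΘg : ∀ B (g : Site 3 1 → SU2) (U : Cfg), Θ B (gaugeTransform g U) = Θ B U)
    (hΘz : ∀ B (j : Fin 3), ∀ z ∈ Subgroup.center SU2, ∀ U : Cfg, Θ B (twist j z U) = Θ B U)
    (hΛ : ∀ B, 0 ≤ Λ B)
    (hLip : ∀ B (U V : Cfg), |Θ B U - Θ B V|
      ≤ Λ B * ∑ e, frobNorm ((U e : Matrix (Fin 2) (Fin 2) ℂ) - (V e : Matrix (Fin 2) (Fin 2) ℂ)))
    (hΛA : ∀ B, B₁ ≤ B → Λ B ^ 2 ≤ A / bareLambda B)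
    (hin : ∀ B, B₁ ≤ B → ∃ φs : Fin k → Cfg → ℝ, (∀ i, IsPhys (φs i)) ∧ ∀ ψ : Cfg → ℝ, IsPhys ψ → (∀ i, l2 ψ (φs i) = 0) →
      qform su2Rep B (fun U => Real.cos (Θ B U) * ψ U) (fun U => Real.cos (Θ B U) * ψ U)
        ≤ linkCE B * Real.exp (-(physLevel (k + 1) * bareLambda B) + C₁ * bareLambda B ^ 2)
          * l2 (fun U => Real.cos (Θ B U) * ψ U) (fun U => Real.cos (Θ B U) * ψ U))
    (hout : ∀ B, B₁ ≤ B → ∀ ψ : Cfg → ℝ, IsPhys ψ →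
      qform su2Rep B (fun U => Real.sin (Θ B U) * ψ U) (fun U => Real.sin (Θ B U) * ψ U)
        ≤ linkCE B * Real.exp (-(physLevel (k + 1) * bareLambda B) + C₁ * bareLambda B ^ 2)
          * l2 (fun U => Real.sin (Θ B U) * ψ U) (fun U => Real.sin (Θ B U) * ψ U)) :
    ∃ C B0 : ℝ, ∀ B : ℝ, B0 ≤ B →
      levelValue su2Rep 1 B k ≤ linkC B ^ 3 * Real.exp (-(physLevel (k + 1) * bareLambda B) + C * bareLambda B ^ 2) := by
  set E := physLevel (k + 1) with hE
  set D : ℝ := 9 / 4 * A * cM2 with hD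
  set M : ℝ := Real.exp (|E| + |C₁|) with hM
  have hD0 : 0 ≤ D := by rw [hD]; have := cM2_pos; positivity
  refine ⟨C₁ + M * D, B₁, fun B hB => ?_⟩
  have hBpos : 0 < B := by linarith
  obtain ⟨hl0, hl1⟩ := bareLambda_pos_le_one (hB₁.trans hB)
  set x := bareLambda B with hx
  obtain ⟨φs, hφ, hinB⟩ := hin B hB
  have hCE : linkCE B = linkC B ^ 3 := by rw [linkCE, card_edge_one]
  have hc0 : 0 ≤ linkC B ^ 3 := pow_nonneg (linkC_pos hBpos.le).le 3
  -- the target Rayleigh bound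
  set a : ℝ := -(E * x) + C₁ * x ^ 2 with ha
  set s : ℝ := linkC B ^ 3 * Real.exp (a + M * D * x ^ 2) with hs
  have hs0 : 0 ≤ s := mul_nonneg hc0 (Real.exp_pos _).le
  have hexp_eq : Real.exp (-(E * x) + (C₁ + M * D) * x ^ 2) = Real.exp (a + M * D * x ^ 2) := by
    rw [ha]; ring_nf
  rw [hexp_eq]
  refine levelValue_le_of_forall_rayleigh_le su2Rep B hs0 φs hφ fun ψ hψ horth _ => ?_
  -- IMS + defect-row bound
  have hims := qform_le_localized_cos_sin hBpos (hΘm B) (hΛ B) (hLip B) (hΘg B) (hΘz B) hψ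
  have hscale := defect_scale (Λ := Λ B) hBpos (hΛA B hB)
  have h1 := hinB ψ hψ horth
  have h2 := hout B hB ψ hψ
  have hsum := l2_cos_mul_add_l2_sin_mul (hΘm B) hψ
  -- abbreviations
  set nc := l2 (fun U => Real.cos (Θ B U) * ψ U) (fun U => Real.cos (Θ B U) * ψ U) with hnc
  set ns := l2 (fun U => Real.sin (Θ B U) * ψ U) (fun U => Real.sin (Θ B U) * ψ U) with hns
  set n := l2 ψ ψ with hn
  have hn0 : 0 ≤ n := by rw [hn]; unfold l2; exact integral_nonneg fun U => mul_self_nonneg _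
  have hrate : 0 ≤ linkCE B * Real.exp a := mul_nonneg (by rw [hCE]; exact hc0) (Real.exp_pos a).le
  -- error coefficient ≤ D x² linkCE
  have herr : (1 / 2) * (9 * Λ B ^ 2 * (cM2 / B) * linkCE B) * n ≤ linkCE B * (D * x ^ 2) * n := by
    have hCE0 : 0 ≤ linkCE B := by rw [hCE]; exact hc0
    have : (1 / 2) * (9 * Λ B ^ 2 * (cM2 / B)) ≤ D * x ^ 2 := by rw [hD]; linarith
    calc (1 / 2) * (9 * Λ B ^ 2 * (cM2 / B) * linkCE B) * n = ((1 / 2) * (9 * Λ B ^ 2 * (cM2 / B))) * linkCE B * n := by ring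
      _ ≤ (D * x ^ 2) * linkCE B * n := mul_le_mul_of_nonneg_right (mul_le_mul_of_nonneg_right this hCE0) hn0
      _ = linkCE B * (D * x ^ 2) * n := by ring
  have hmain : qform su2Rep B ψ ψ ≤ linkCE B * (Real.exp a + D * x ^ 2) * n := by
    calc qform su2Rep B ψ ψ ≤ linkCE B * Real.exp a * nc + linkCE B * Real.exp a * ns
          + (1 / 2) * (9 * Λ B ^ 2 * (cM2 / B) * linkCE B) * n := by linarith [hims, h1, h2]
      _ = linkCE B * Real.exp a * n + (1 / 2) * (9 * Λ B ^ 2 * (cM2 / B) * linkCE B) * n := by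
          rw [← hsum]; ring
      _ ≤ linkCE B * Real.exp a * n + linkCE B * (D * x ^ 2) * n := by linarith [herr]
      _ = linkCE B * (Real.exp a + D * x ^ 2) * n := by ring
  -- absorb `D x²` into the exponent
  have hMbd : Real.exp (-a) ≤ M := by
    rw [hM]
    apply Real.exp_le_exp.mpr
    rw [ha]
    have h3 : E * x ≤ |E| := by
      calc E * x ≤ |E| * x := mul_le_mul_of_nonneg_right (le_abs_self E) hl0.le
        _ ≤ |E| * 1 := mul_le_mul_of_nonneg_left hl1 (abs_nonneg E)
        _ = |E| := mul_one _
    have h4 : -(C₁ * x ^ 2) ≤ |C₁| := by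
      have hx2 : x ^ 2 ≤ 1 := by nlinarith
      calc -(C₁ * x ^ 2) ≤ |C₁| * x ^ 2 := by nlinarith [neg_abs_le C₁, sq_nonneg x]
        _ ≤ |C₁| * 1 := mul_le_mul_of_nonneg_left hx2 (abs_nonneg _)
        _ = |C₁| := mul_one _
    linarith
  have habs := exp_add_mul_sq_le (x := x) hD0 hMbd
  calc qform su2Rep B ψ ψ ≤ linkCE B * (Real.exp a + D * x ^ 2) * n := hmain
    _ ≤ linkCE B * Real.exp (a + M * D * x ^ 2) * n := by
        refine mul_le_mul_of_nonneg_right (mul_le_mul_of_nonneg_left habs (by rw [hCE]; exact hc0)) hn0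
    _ = s * n := by rw [hs, hCE]

end Summit.QuantumFields.YangMills.Theorems.FemtoTransferGap

end
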